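import Literature.ModelTheory.ExponentialFields.PilaWilkieLimitChartsCover
import Literature.ModelTheory.ExponentialFields.PilaWilkieUnaryParametrizationCr
import HarnessLib

/-!
# The limit charts of a definable family of parametrizations (Bhardwaj–van den Dries 2022, Lemma 6.1, uniform)

Topic `Literature/ModelTheory/ExponentialFields`; proof file in the cone of the named fact
`PilaWilkie2006_thm_1_8`.  Bhardwaj–van den Dries 2022, Lemma 6.1: for a definable family
`(Φ_s)_{0<s<1}` of `k`-parametrizations of `(0,1)` the limit set `Φ₀ = lim_{s→0} Φ_s` is a
partial `(k−1)`-parametrization whose images cover a cofinite subset of `(0,1)` (A), with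
convergence of the charts (B) and of their derivatives (C).  Here over `ℝ`, uniformly in
outer parameters `v`, with o-minimal one-sided limits (`definableFun_limRight`,
`exists_tendsto_nhdsGT_of_bounded`) in place of `ℵ₀`-saturation and standard parts, the
smoothness of the limit from `PilaWilkie2006_sec4_limit`, and (A) from
`finite_compl_iUnion_image_limitCharts`:

* `IsDefinableFamily₁.iteratedDeriv` — iterated derivatives of definable families;
* **`limitCharts`** — the statement above.

Nothing here is a named fact; no definitions.

## References

* N. Bhardwaj, L. van den Dries, *On the Pila–Wilkie theorem*, Expo. Math. 40 (2022), §6,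
  Lemma 6.1. [BhardwajVanDenDries2022]
* J. Pila, A. J. Wilkie, *The rational points of a definable set*, Duke Math. J. 133 (2006),
  §4 (limits of parametrizations). [PilaWilkie2006]
-/

noncomputable section

open Set FirstOrder FirstOrder.Language Filter Topology Function

namespace Literature.ModelTheory.ExponentialFields

/-! ### Bhardwaj–van den Dries 2022, Lemma 6.1, uniformly in parameters -/

section LimitCharts

open Classical

variable {L : Language} [L.Structure ℝ]

/-- Iterated derivatives of a definable family are a definable family (on the nose, via
`iteratedDeriv = deriv^[n]`). [folklore] -/
theorem IsDefinableFamily₁.iteratedDeriv {β : Type} [Finite β]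
    (hadd : (univ : Set ℝ).Definable L {v : Fin 3 → ℝ | v 0 + v 1 = v 2})
    (hmul : (univ : Set ℝ).Definable L {v : Fin 3 → ℝ | v 0 * v 1 = v 2})
    {Φ : (β → ℝ) → ℝ → ℝ} (hΦ : IsDefinableFamily₁ L Φ) :
    ∀ n : ℕ, IsDefinableFamily₁ L (fun v x => _root_.iteratedDeriv n (Φ v) x)
  | 0 => by simpa using hΦ
  | n + 1 => by
    have h := (IsDefinableFamily₁.iteratedDeriv hadd hmul hΦ n).deriv hadd hmul
    simp only [iteratedDeriv_succ]
    exact h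

/-- **Bhardwaj–van den Dries 2022, Lemma 6.1, uniformly in parameters over `ℝ`**: for a
definable family, in the parameters `(v, s)`, of `k`-parametrizations `{F_j((v,s), ·)}` of
`(0,1)` by charts `(0,1) → (0,1)` with `|F^{(i)}| ≤ 1` (`i ≤ k`, `k ≥ 2`), the one-sided limits
`G_j(v, ·) = lim_{s → 0⁺} F_j((v,s), ·)` form definable families of `C^{k−1}` functions
`(0,1) → [0,1]` with `|G^{(i)}| ≤ 1` (`i ≤ k − 1`), the derivatives of order `< k` converge
pointwise, and (A) the images of the `G_j(v,·)` cover `(0,1)` up to finitely many points.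
(Limits exist by o-minimality instead of `ℵ₀`-saturation/standard parts.)
[cite: BhardwajVanDenDries2022, Lemma 6.1] -/
theorem limitCharts {p k : ℕ} (hO : L.IsOMinimal ℝ)
    (hadd : (univ : Set ℝ).Definable L {v : Fin 3 → ℝ | v 0 + v 1 = v 2})
    (hmul : (univ : Set ℝ).Definable L {v : Fin 3 → ℝ | v 0 * v 1 = v 2})
    (hk : 2 ≤ k) {J : Type} [Fintype J]
    (F : J → (Fin (p + 1) → ℝ) → ℝ → ℝ) (hF : ∀ j, IsDefinableFamily₁ L (F j))
    (hCk : ∀ j w, ContDiffOn ℝ k (F j w) (Ioo 0 1))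
    (hbd : ∀ j w, ∀ i ≤ k, ∀ t ∈ Ioo (0 : ℝ) 1, |iteratedDerivWithin i (F j w) (Ioo 0 1) t| ≤ 1)
    (hmaps : ∀ j w, MapsTo (F j w) (Ioo 0 1) (Ioo 0 1))
    (hcov : ∀ w, Ioo (0 : ℝ) 1 ⊆ ⋃ j, F j w '' Ioo 0 1) :
    ∃ G : J → (Fin p → ℝ) → ℝ → ℝ, (∀ j, IsDefinableFamily₁ L (G j)) ∧
      ∀ v, (∀ j, ContDiffOn ℝ ((k - 1 : ℕ) : WithTop ℕ∞) (G j v) (Ioo 0 1)) ∧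
        (∀ j, ∀ i ≤ k - 1, ∀ t ∈ Ioo (0 : ℝ) 1, |iteratedDerivWithin i (G j v) (Ioo 0 1) t| ≤ 1) ∧
        (∀ j, MapsTo (G j v) (Ioo 0 1) (Icc 0 1)) ∧
        (∀ j, ∀ i < k, ∀ t ∈ Ioo (0 : ℝ) 1,
          Tendsto (fun s => iteratedDerivWithin i (F j (Fin.snoc v s)) (Ioo 0 1) t) (𝓝[>] 0)
            (𝓝 (iteratedDerivWithin i (G j v) (Ioo 0 1) t))) ∧
        (Ioo (0 : ℝ) 1 \ ⋃ j, G j v '' Ioo 0 1).Finite := by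
  have hlt := definable_lt_of_field hadd hmul
  have hk1 : 1 ≤ k := by omega
  -- the family in the limit variable `s`, parameters `(v, t)`
  have hFs : ∀ j, IsDefinableFamily₁ L (fun (u : Fin p ⊕ Unit → ℝ) (s : ℝ) =>
      F j (Fin.snoc (fun i => u (Sum.inl i)) s) (u (Sum.inr ()))) := by
    intro j γ _ qm tm hqm htm
    refine (hF j).definableFun (q := fun e => Fin.snoc (fun i => qm e (Sum.inl i)) (tm e)) (t := fun e => qm e (Sum.inr ()))
      (fun l => ?_) (hqm _)
    refine Fin.lastCases ?_ (fun i => ?_) l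
    · simp only [Fin.snoc_last]; exact htm
    · simp only [Fin.snoc_castSucc]; exact hqm _
  -- the limit family
  set G : J → (Fin p → ℝ) → ℝ → ℝ := fun j v t =>
    if h : ∃ y, Tendsto (fun s => F j (Fin.snoc v s) t) (𝓝[>] 0) (𝓝 y) then h.choose else 0 with hG
  have hGdef : ∀ j, IsDefinableFamily₁ L (G j) := by
    intro j γ _ qm tm hqm htm
    have h := definableFun_limRight hadd hmul (hFs j)
    have h' := h.comp (show (univ : Set ℝ).DefinableMap L (fun (e : γ → ℝ) (l : Fin p ⊕ Unit) =>
        Sum.elim (qm e) (fun _ => tm e) l) from fun l => by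
      cases l with
      | inl i => exact hqm i
      | inr _ => exact htm)
    exact h'
  refine ⟨G, hGdef, fun v => ?_⟩
  -- for fixed `v`: the limit theorem, chart by chart
  have hchart : ∀ j, ∃ g : ℝ → ℝ, ContDiffOn ℝ ((k - 1 : ℕ) : WithTop ℕ∞) g (Ioo 0 1) ∧
      (∀ i < k, ∀ t ∈ Ioo (0 : ℝ) 1,
        Tendsto (fun s => iteratedDerivWithin i (F j (Fin.snoc v s)) (Ioo 0 1) t) (𝓝[>] 0)
          (𝓝 (iteratedDerivWithin i g (Ioo 0 1) t))) ∧
      (∀ i < k, ∀ t ∈ Ioo (0 : ℝ) 1, |iteratedDerivWithin i g (Ioo 0 1) t| ≤ 1) := by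
    intro j
    refine PilaWilkie2006_sec4_limit (l := 𝓝[>] (0 : ℝ)) hk1 zero_le_one (f := fun s => F j (Fin.snoc v s))
      (fun s => hCk j _) (fun s i hi t ht => hbd j _ i hi t ht) fun i hi t ht => ?_
    -- limits of the derivatives exist by o-minimality
    have hfam := IsDefinableFamily₁.iteratedDeriv hadd hmul (hF j) i
    have heq : (fun s => iteratedDerivWithin i (F j (Fin.snoc v s)) (Ioo 0 1) t) =
        fun s => _root_.iteratedDeriv i (F j (Fin.snoc v s)) t := by
      funext s; exact iteratedDerivWithin_of_isOpen isOpen_Ioo ht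
    rw [heq]
    refine exists_tendsto_nhdsGT_of_bounded hO hlt ?_ one_pos (c := 1) fun s hs => ?_
    · have h := definable_graph_of_family (Φ := fun (_ : Fin 0 → ℝ) s => _root_.iteratedDeriv i (F j (Fin.snoc v s)) t)
        (fun γ _ q' t' _ ht' => hfam.definableFun (q := fun e => Fin.snoc v (t' e)) (t := fun _ => t)
          (fun l => by
            refine Fin.lastCases ?_ (fun i => ?_) l
            · simp only [Fin.snoc_last]; exact ht'
            · simp only [Fin.snoc_castSucc]; exact definableFun_const' _ _)
          (definableFun_const' _ _)) Fin.elim0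
      simpa using h
    · rw [← iteratedDerivWithin_of_isOpen isOpen_Ioo ht]
      exact hbd j _ i hi.le t ht
  choose g hgk hglim hgbd using hchart
  -- `G j v = g j` on `(0,1)`
  have hGg : ∀ j, EqOn (G j v) (g j) (Ioo 0 1) := by
    intro j t ht
    have hl := hglim j 0 (by omega) t ht
    simp only [iteratedDerivWithin_zero] at hl
    have hex : ∃ y, Tendsto (fun s => F j (Fin.snoc v s) t) (𝓝[>] 0) (𝓝 y) := ⟨_, hl⟩
    simp only [hG, dif_pos hex]
    exact tendsto_nhds_unique hex.choose_spec hl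
  have hGit : ∀ j i, EqOn (iteratedDerivWithin i (G j v) (Ioo 0 1)) (iteratedDerivWithin i (g j) (Ioo 0 1)) (Ioo 0 1) :=
    fun j i => iteratedDerivWithin_congr (hGg j)
  refine ⟨fun j => (hgk j).congr (hGg j), fun j i hi t ht => ?_, fun j t ht => ?_, fun j i hi t ht => ?_, ?_⟩
  · rw [hGit j i ht]; exact hgbd j i (by omega) t ht
  · -- values in `[0, 1]`
    have hl := hglim j 0 (by omega) t ht
    simp only [iteratedDerivWithin_zero] at hl
    rw [hGg j ht]
    refine isClosed_Icc.mem_of_tendsto hl ?_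
    filter_upwards [self_mem_nhdsWithin] with s _ using Ioo_subset_Icc_self (hmaps j _ ht)
  · rw [hGit j i ht]; exact hglim j i hi t ht
  · -- (A): cofinite cover, by `finite_compl_iUnion_image_limitCharts`
    refine finite_compl_iUnion_image_limitCharts hO hadd hmul (fun j s t => F j (Fin.snoc v s) t) (fun j => G j v)
      (fun j => ?_) (fun j => (hGdef j).definable_graph v) (fun s _ => hcov _) (fun j s _ => ?_) (fun j t ht => ?_)
      (fun j => (hgk j).continuousOn.congr (hGg j))
    · intro γ _ qm tm hqm htm
      exact (hFs j).definableFun (q := fun e => Sum.elim v (fun _ => tm e)) (t := fun e => qm e 0)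
        (fun l => by cases l with
          | inl i => exact definableFun_const' _ _
          | inr _ => exact htm) (hqm 0)
    · exact lipschitzOnWith_of_deriv_bound ((hCk j _).differentiableOn (by exact_mod_cast Nat.one_le_iff_ne_zero.mp hk1))
        fun x hx => by
          have := hbd j (Fin.snoc v s) 1 hk1 x hx
          rw [iteratedDerivWithin_one, derivWithin_of_isOpen isOpen_Ioo hx] at this
          exact_mod_cast this
    · have hl := hglim j 0 (by omega) t ht
      simp only [iteratedDerivWithin_zero] at hl
      rw [← hGg j ht] at hl
      exact hl

end LimitCharts


end Literature.ModelTheory.ExponentialFields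

end
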